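import Summits.BirchSwinnertonDyer.BirchSwinnertonDyer.Theorems.ShaPrimaryTransferFiniteShaComponentTransferZywinaEqualityDoorInfinite
import Literature.NumberTheory.EllipticCurves.BSDRankZeroDensityProofs
import Literature.NumberTheory.EllipticCurves.BSDSelmerCMPConverseRankOneProofs
import HarnessLib

/-!
# BirchSwinnertonDyer / ShaPrimaryTransfer — crux `FiniteShaComponentTransfer` (stmt-BirchSwinnertonDyer-22356):
# the DESCENT FORM of the door's extra input — `#Sel^{(5)}(E_{m,n}/ℚ) = 25`

Companion of `…ZywinaEqualityDoor` (p762237), `…Primes` (p762511), `…Kato` (p762672), `…Infinite` (p762756).  Those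
files isolate the ONE input the `5`-adic equality door on Zywina's rank-2 family needs: `Ш(E_{m,n})[5^∞]` finite.  This
file pushes that input down to a FINITE group: by the descent count `#Sel^{(p)}(E/K) = p^{rank} · #E(K)[p] · #Ш(E/K)[p]`
(Silverman X.4.2; tree theorem `natCard_selmerGroup_eq`) and `E_{m,n}(ℚ)_tors = ℤ/2` (Zywina, Lemma 3.4; tree), for
every odd prime `p`:  `p² ∣ #Sel^{(p)}(E_{m,n}/ℚ)` and `#Sel^{(p)}(E_{m,n}/ℚ) = p² ⟺ Ш(E_{m,n})[p] = 0 ⟹ Ш(E_{m,n})[p^∞] = 0`.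
Hence the door's key in descent currency: a `5`-descent showing `#Sel^{(5)}(E_{m,n}/ℚ) = 25` gives (mod PRS 85 + BCS,
given `Reg_5 ≠ 0`) `ord_{T=0} L_5(E_{m,n},T) = 2`, and T's instance `(E_{m,n}, 2, 5)` outright.

* §1 general `E/K`: `torsionBy_eq_bot_of_coprime_torsionOrder`, `natCard_selmerGroup_eq_of_coprime_torsionOrder`,
  `pow_dvd_natCard_selmerGroup`, `natCard_selmerGroup_eq_pow_iff`, `primaryComponent_sha_eq_bot_of_natCard_selmerGroup_eq_pow`.
* §2 Zywina: `coprime_torsionOrder_zywinaCurve` (`p` odd), `natCard_selmerGroup_zywinaCurve`, `sq_dvd_natCard_selmerGroup_zywinaCurve`,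
  `natCard_selmerGroup_zywinaCurve_eq_sq_iff`, `shaCorank_eq_zero_of_natCard_selmerGroup_zywinaCurve`,
  `order_eq_two_of_natCard_selmerGroup_five_zywinaCurve` (THE DESCENT KEY), `transfer_instance_of_natCard_selmerGroup_five`.
* §3 on the infinite class (mod `hInf` of `…Infinite`): `infinite_setOf_j_rankTwo_descentDoor_five`.

PARTITION: r_an ≥ 2 side; S0 not touched (B1 honesty: a descent bound is an UPPER Selmer bound on a family whose rank is a
theorem — evasion (i) of `Literature.Barriers.BirchSwinnertonDyer.SelmerRankBarrierNarrow` done family-wise on the points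
side, per member on the Selmer side; no analytic rank is bounded).  References: J. H. Silverman, AEC (2009) Thm. X.4.2;
D. Zywina, arXiv:2502.01957 Lemma 3.4, Thm. 1.2; K. Kato, Astérisque 295 (2004) Thm. 17.4; Balakrishnan–Müller–Stein,
Math. Comp. 85 (2016) Thm. 1.7; Burungale–Castella–Skinner (2025) Thm. 1.1.2.
-/

-- D-0017: single-problem summit, so `Summit.BirchSwinnertonDyer.BirchSwinnertonDyer.…` repeats a namespace BY DESIGN.
set_option linter.dupNamespace false

noncomputable section

namespace Summit.BirchSwinnertonDyer.BirchSwinnertonDyer.Theorems.ShaPrimaryTransferZywinaEqualityDoorDescent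

open scoped MatrixGroups ModularForm
open CongruenceSubgroup
open Literature.NumberTheory.EllipticCurves Literature.NumberTheory.EllipticCurves.Zywina2025
  Literature.NumberTheory.EllipticCurves.ModularForms
open WeierstrassCurve
open Summit.BirchSwinnertonDyer.BirchSwinnertonDyer.Rank1Residual
open Summit.BirchSwinnertonDyer.Rank1Residual.Additive
open Summit.BirchSwinnertonDyer.BirchSwinnertonDyer.Theses.ShaPrimaryTransfer (FiniteShaComponentTransfer)
open Summit.BirchSwinnertonDyer.BirchSwinnertonDyer.Theorems.ShaPrimaryTransferGoodOrdinaryFive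
open Summit.BirchSwinnertonDyer.BirchSwinnertonDyer.Theorems.ShaPrimaryTransferZywinaEqualityDoor
open Summit.BirchSwinnertonDyer.BirchSwinnertonDyer.Theorems.ShaPrimaryTransferZywinaEqualityDoorKato
open Summit.BirchSwinnertonDyer.BirchSwinnertonDyer.Theorems.ShaPrimaryTransferZywinaEqualityDoorInfinite

/-! ## §1 General `E/K`: the descent count when `E(K)[p] = 0` -/

section General

/- Tree convention (`Literature/NumberTheory/EllipticCurves/MordellWeil.lean`): the group law on `E(K)` is taken with
the classical `DecidableEq K`, as in `natCard_selmerGroup_eq` and `torsionOrder`. -/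
open scoped Classical

variable {K : Type} [Field K] [NumberField K] (W : WeierstrassCurve K)

omit [NumberField K] in
/-- **`E(K)[p] = 0` as soon as `gcd(p, #E(K)_tors) = 1`** (the order of a `p`-torsion point divides both).
[folklore] -/
theorem torsionBy_eq_bot_of_coprime_torsionOrder {p : ℕ} (hp : 0 < p) (hcop : Nat.Coprime p W.torsionOrder) :
    AddSubgroup.torsionBy W.toAffine.Point (p : ℤ) = ⊥ := by
  rw [eq_bot_iff]
  intro P hP
  rw [AddSubgroup.torsionBy.nsmul_iff] at hP
  have hfin : IsOfFinAddOrder P := isOfFinAddOrder_iff_nsmul_eq_zero.mpr ⟨p, hp, hP⟩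
  have hmem : P ∈ AddCommGroup.torsion W.toAffine.Point := (AddCommGroup.mem_torsion _).mpr hfin
  have hd1 : addOrderOf P ∣ p := addOrderOf_dvd_of_nsmul_eq_zero hP
  have hd2 : addOrderOf P ∣ W.torsionOrder := by
    have hT := addOrderOf_dvd_natCard (⟨P, hmem⟩ : AddCommGroup.torsion W.toAffine.Point)
    have e : addOrderOf P = addOrderOf (⟨P, hmem⟩ : AddCommGroup.torsion W.toAffine.Point) :=
      addOrderOf_injective (AddCommGroup.torsion W.toAffine.Point).subtype
        (AddCommGroup.torsion W.toAffine.Point).subtype_injective ⟨P, hmem⟩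
    rw [← e] at hT
    exact hT
  have hd : addOrderOf P ∣ Nat.gcd p W.torsionOrder := Nat.dvd_gcd hd1 hd2
  rw [Nat.Coprime.gcd_eq_one hcop, Nat.dvd_one] at hd
  exact AddSubgroup.mem_bot.mpr (AddMonoid.addOrderOf_eq_one_iff.mp hd)

variable [W.IsElliptic]

/-- **`#Sel^{(p)}(E/K) = p^{rank E(K)} · #Ш(E/K)[p]` when `E(K)[p] = 0`** (Silverman X.4.2 (a)(b): the exact sequence
`0 → E(K)/pE(K) → Sel^{(p)} → Ш[p] → 0`; tree `natCard_selmerGroup_eq`). [cite: SilvermanAEC2009, Thm X.4.2] -/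
theorem natCard_selmerGroup_eq_of_torsionBy_eq_bot {p : ℕ} (hp : p ≠ 0)
    (htors : AddSubgroup.torsionBy W.toAffine.Point (p : ℤ) = ⊥) :
    Nat.card (W.selmerGroup p) =
      p ^ W.mordellWeilRank * Nat.card (W.sha ⊓ AddSubgroup.torsionBy W.galH1 p : AddSubgroup W.galH1) := by
  have h := W.natCard_selmerGroup_eq hp
  rw [htors, AddSubgroup.card_bot, mul_one] at h
  exact h

/-- **`#Sel^{(p)}(E/K) = p^{rank E(K)} · #Ш(E/K)[p]` when `gcd(p, #E(K)_tors) = 1`.** [cite: SilvermanAEC2009, Thm X.4.2] -/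
theorem natCard_selmerGroup_eq_of_coprime_torsionOrder {p : ℕ} (hp : p ≠ 0) (hcop : Nat.Coprime p W.torsionOrder) :
    Nat.card (W.selmerGroup p) =
      p ^ W.mordellWeilRank * Nat.card (W.sha ⊓ AddSubgroup.torsionBy W.galH1 p : AddSubgroup W.galH1) :=
  natCard_selmerGroup_eq_of_torsionBy_eq_bot W hp
    (torsionBy_eq_bot_of_coprime_torsionOrder W (Nat.pos_of_ne_zero hp) hcop)

/-- **`p^{rank E(K)} ∣ #Sel^{(p)}(E/K)` when `gcd(p, #E(K)_tors) = 1`.** [cite: SilvermanAEC2009, Thm X.4.2] -/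
theorem pow_dvd_natCard_selmerGroup {p : ℕ} (hp : p ≠ 0) (hcop : Nat.Coprime p W.torsionOrder) :
    p ^ W.mordellWeilRank ∣ Nat.card (W.selmerGroup p) :=
  Dvd.intro _ (natCard_selmerGroup_eq_of_coprime_torsionOrder W hp hcop).symm

/-- **`#Sel^{(p)}(E/K) = p^{rank E(K)} ⟺ Ш(E/K)[p] = 0` when `gcd(p, #E(K)_tors) = 1`** (`p ≥ 1`).
[cite: SilvermanAEC2009, Thm X.4.2] -/
theorem natCard_selmerGroup_eq_pow_iff {p : ℕ} (hp : p ≠ 0) (hcop : Nat.Coprime p W.torsionOrder) :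
    Nat.card (W.selmerGroup p) = p ^ W.mordellWeilRank ↔
      (W.sha ⊓ AddSubgroup.torsionBy W.galH1 p : AddSubgroup W.galH1) = ⊥ := by
  rw [natCard_selmerGroup_eq_of_coprime_torsionOrder W hp hcop]
  have hpow : p ^ W.mordellWeilRank ≠ 0 := pow_ne_zero _ hp
  constructor
  · intro h
    refine AddSubgroup.eq_bot_of_card_eq _ ?_
    have h' : p ^ W.mordellWeilRank *
        Nat.card (W.sha ⊓ AddSubgroup.torsionBy W.galH1 p : AddSubgroup W.galH1) =
          p ^ W.mordellWeilRank * 1 := by rw [mul_one]; exact h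
    exact Nat.eq_of_mul_eq_mul_left (Nat.pos_of_ne_zero hpow) h'
  · intro h
    rw [h, AddSubgroup.card_bot, mul_one]

/-- **A `p`-descent showing `#Sel^{(p)}(E/K) = p^{rank E(K)}` (`p` prime to `#E(K)_tors`) gives `Ш(E/K)[p^∞] = 0`**
(`Ш[p] = 0 ⟹ Ш[p^∞] = 0`: tree `primaryComponent_sha_eq_bot_of_inf_torsionBy_eq_bot`).
[cite: SilvermanAEC2009, Thm X.4.2] -/
theorem primaryComponent_sha_eq_bot_of_natCard_selmerGroup_eq_pow (p : ℕ) [Fact p.Prime]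
    (hcop : Nat.Coprime p W.torsionOrder) (hSel : Nat.card (W.selmerGroup p) = p ^ W.mordellWeilRank) :
    AddCommGroup.primaryComponent W.sha p = ⊥ :=
  primaryComponent_sha_eq_bot_of_inf_torsionBy_eq_bot W p
    ((natCard_selmerGroup_eq_pow_iff W (Fact.out : p.Prime).ne_zero hcop).mp hSel)

/-- Same, as finiteness of `Ш(E/K)[p^∞]` and `t_p(E/K) = 0`. [cite: SilvermanAEC2009, Thm X.4.2] -/
theorem finite_primaryComponent_sha_of_natCard_selmerGroup_eq_pow (p : ℕ) [Fact p.Prime]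
    (hcop : Nat.Coprime p W.torsionOrder) (hSel : Nat.card (W.selmerGroup p) = p ^ W.mordellWeilRank) :
    Finite (AddCommGroup.primaryComponent W.sha p) ∧ W.shaCorank p = 0 := by
  have hfin : Finite (AddCommGroup.primaryComponent W.sha p) :=
    Nat.finite_of_card_ne_zero
      (by rw [primaryComponent_sha_eq_bot_of_natCard_selmerGroup_eq_pow W p hcop hSel, AddSubgroup.card_bot]
          exact one_ne_zero)
  exact ⟨hfin, (finite_primaryComponent_sha_iff_shaCorank_eq_zero W p).mp hfin⟩

end General

/-! ## §2 Zywina's family: `#E_{m,n}(ℚ)_tors = 2`, so `#Sel^{(p)} = p² · #Ш[p]` for odd `p` -/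

section Zywina

variable {m n : ℕ}

/-- **`gcd(p, #E_{m,n}(ℚ)_tors) = 1` for every odd prime `p`** (`E_{m,n}(ℚ)_tors = ℤ/2`: Zywina, Lemma 3.4; tree
`torsionOrder_zywinaCurve`). [cite: Zywina2025, Lemma 3.4] -/
theorem coprime_torsionOrder_zywinaCurve (h : ZywinaAdmissible m n) {p : ℕ} (hp : p.Prime) (hp2 : p ≠ 2) :
    Nat.Coprime p (zywinaCurve m n).torsionOrder := by
  rw [torsionOrder_zywinaCurve h]
  exact (Nat.coprime_primes hp Nat.prime_two).mpr hp2

/-- **`#Sel^{(p)}(E_{m,n}/ℚ) = p² · #Ш(E_{m,n})[p]`** for every odd prime `p` (rank `2`: Zywina Thm 1.2; torsion `ℤ/2`).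
[cite: Zywina2025, Thm 1.2] [cite: SilvermanAEC2009, Thm X.4.2] -/
theorem natCard_selmerGroup_zywinaCurve (h : ZywinaAdmissible m n) {p : ℕ} (hp : p.Prime) (hp2 : p ≠ 2)
    [(zywinaCurve m n).IsElliptic] :
    Nat.card ((zywinaCurve m n).selmerGroup p) =
      p ^ 2 * Nat.card ((zywinaCurve m n).sha ⊓ AddSubgroup.torsionBy (zywinaCurve m n).galH1 p :
        AddSubgroup (zywinaCurve m n).galH1) := by
  have key := natCard_selmerGroup_eq_of_coprime_torsionOrder (zywinaCurve m n) hp.ne_zero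
    (coprime_torsionOrder_zywinaCurve h hp hp2)
  rwa [mordellWeilRank_zywinaCurve h] at key

/-- **`p² ∣ #Sel^{(p)}(E_{m,n}/ℚ)`** for every odd prime `p` — the two independent points are always visible to descent.
[cite: Zywina2025, Thm 1.2] [cite: SilvermanAEC2009, Thm X.4.2] -/
theorem sq_dvd_natCard_selmerGroup_zywinaCurve (h : ZywinaAdmissible m n) {p : ℕ} (hp : p.Prime) (hp2 : p ≠ 2)
    [(zywinaCurve m n).IsElliptic] :
    p ^ 2 ∣ Nat.card ((zywinaCurve m n).selmerGroup p) :=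
  Dvd.intro _ (natCard_selmerGroup_zywinaCurve h hp hp2).symm

/-- **`#Sel^{(p)}(E_{m,n}/ℚ) = p² ⟺ Ш(E_{m,n})[p] = 0`** (odd prime `p`). [cite: Zywina2025, Thm 1.2]
[cite: SilvermanAEC2009, Thm X.4.2] -/
theorem natCard_selmerGroup_zywinaCurve_eq_sq_iff (h : ZywinaAdmissible m n) {p : ℕ} (hp : p.Prime) (hp2 : p ≠ 2)
    [(zywinaCurve m n).IsElliptic] :
    Nat.card ((zywinaCurve m n).selmerGroup p) = p ^ 2 ↔
      ((zywinaCurve m n).sha ⊓ AddSubgroup.torsionBy (zywinaCurve m n).galH1 p :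
        AddSubgroup (zywinaCurve m n).galH1) = ⊥ := by
  have key := natCard_selmerGroup_eq_pow_iff (zywinaCurve m n) hp.ne_zero (coprime_torsionOrder_zywinaCurve h hp hp2)
  rwa [mordellWeilRank_zywinaCurve h] at key

/-- **A `p`-descent with `#Sel^{(p)}(E_{m,n}/ℚ) = p²` gives `Ш(E_{m,n})[p^∞] = 0` and `t_p(E_{m,n}) = 0`** (odd prime `p`).
[cite: Zywina2025, Thm 1.2] [cite: SilvermanAEC2009, Thm X.4.2] -/
theorem shaCorank_eq_zero_of_natCard_selmerGroup_zywinaCurve (h : ZywinaAdmissible m n) (p : ℕ) [Fact p.Prime]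
    (hp2 : p ≠ 2) [(zywinaCurve m n).IsElliptic] (hSel : Nat.card ((zywinaCurve m n).selmerGroup p) = p ^ 2) :
    AddCommGroup.primaryComponent (zywinaCurve m n).sha p = ⊥ ∧
      Finite (AddCommGroup.primaryComponent (zywinaCurve m n).sha p) ∧ (zywinaCurve m n).shaCorank p = 0 := by
  have hp : p.Prime := Fact.out
  have hSel' : Nat.card ((zywinaCurve m n).selmerGroup p) = p ^ (zywinaCurve m n).mordellWeilRank := by
    rw [mordellWeilRank_zywinaCurve h]; exact hSel
  exact ⟨primaryComponent_sha_eq_bot_of_natCard_selmerGroup_eq_pow (zywinaCurve m n) p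
      (coprime_torsionOrder_zywinaCurve h hp hp2) hSel',
    finite_primaryComponent_sha_of_natCard_selmerGroup_eq_pow (zywinaCurve m n) p
      (coprime_torsionOrder_zywinaCurve h hp hp2) hSel'⟩

/-- **THE DESCENT KEY OF THE `5`-ADIC DOOR.** On `E_{m,n}` (admissible, `7 ∣ n`), modulo PRS 85 (`h85`) and BCS (`hMC`)
and given `Reg_5(E_{m,n}) ≠ 0`: a `5`-descent showing `#Sel^{(5)}(E_{m,n}/ℚ) = 25` forces `ord_{T=0} L_5(E_{m,n},T) = 2`.
CONDITIONAL on `h85`, `hMC`. [cite: BalakrishnanMullerStein2015, Thm. 1.7] [cite: BurungaleCastellaSkinner2025, Thm. 1.1.2 (a)]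
[cite: SilvermanAEC2009, Thm X.4.2] [cite: Zywina2025, Thm 1.2] -/
theorem order_eq_two_of_natCard_selmerGroup_five_zywinaCurve [Fact (Nat.Prime 5)]
    (h85 : Schneider1985_order_charGenerator) (hMC : burungale_castella_skinner_charIdeal_eq_padicLFunction)
    (h : ZywinaAdmissible m n) (h7 : 7 ∣ n) [(zywinaCurve m n).IsElliptic] [(zywinaCurve m n).IsGloballyMinimal]
    (hReg : ∀ D : PAdicHeightData (zywinaCurve m n) 5, D.IsCanonical → SchneiderConjecture D)
    {N : ℕ} [NeZero N] {f : CuspForm (Gamma0 N) 2} (hf : IsNewformOf (zywinaCurve m n) f)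
    (hSel : Nat.card ((zywinaCurve m n).selmerGroup (5 : ℕ)) = 5 ^ 2) :
    (padicLFunction f (unitRoot (zywinaCurve m n) 5 : ℚ_[5])).order = 2 :=
  (equalityDoor_five_zywinaCurve h85 hMC h h7 hReg hf).mpr
    (shaCorank_eq_zero_of_natCard_selmerGroup_zywinaCurve h 5 (by norm_num) hSel).2.1

/-- **T's instance `(E_{m,n}, 2, 5)` from a `5`-descent** (unconditional): `#Sel^{(5)}(E_{m,n}/ℚ) = 25 ⟹ t_5(E_{m,n}) = 0`,
so `t_2 = 0 → t_5 = 0` holds. [cite: Zywina2025, Thm 1.2] [cite: SilvermanAEC2009, Thm X.4.2] -/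
theorem transfer_instance_of_natCard_selmerGroup_five [Fact (Nat.Prime 5)] [Fact (Nat.Prime 2)]
    (h : ZywinaAdmissible m n) [(zywinaCurve m n).IsElliptic]
    (hSel : Nat.card ((zywinaCurve m n).selmerGroup (5 : ℕ)) = 5 ^ 2) :
    (zywinaCurve m n).shaCorank 2 = 0 → (zywinaCurve m n).shaCorank 5 = 0 :=
  fun _ ↦ (shaCorank_eq_zero_of_natCard_selmerGroup_zywinaCurve h 5 (by norm_num) hSel).2.2

/-- **The asymmetric budget in descent currency**: `#Sel^{(5)} = 25 ⟹ Ш[5^∞] = 0` (unconditional) whereas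
`ord_{T=0} L_5 = 2 ⟹ Ш[5^∞]` finite (PRS 85 + Kato) — the analytic key does NOT give `#Sel^{(5)} = 25` (a finite
non-zero `Ш[5]` is allowed); the descent key is strictly stronger on the `Ш`-side. Recorded as the pair of implications.
CONDITIONAL on `h85` (and Kato's divisibility per curve). [cite: Kato2004Asterisque, Thm. 17.4 (1)(2) (p. 273)]
[cite: BalakrishnanMullerStein2015, Thm. 1.7] [cite: SilvermanAEC2009, Thm X.4.2] -/
theorem descent_and_analytic_keys_five_zywinaCurve [Fact (Nat.Prime 5)] (h85 : Schneider1985_order_charGenerator)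
    (h : ZywinaAdmissible m n) [(zywinaCurve m n).IsElliptic] [(zywinaCurve m n).IsGloballyMinimal]
    {N : ℕ} [NeZero N] {f : CuspForm (Gamma0 N) 2} (hf : IsNewformOf (zywinaCurve m n) f)
    (hkato : kato_divisibility_allPrimes (zywinaCurve m n) 5 (f := f)) :
    (Nat.card ((zywinaCurve m n).selmerGroup (5 : ℕ)) = 5 ^ 2 →
        AddCommGroup.primaryComponent (zywinaCurve m n).sha 5 = ⊥) ∧
      ((padicLFunction f (unitRoot (zywinaCurve m n) 5 : ℚ_[5])).order = 2 →
        Finite (AddCommGroup.primaryComponent (zywinaCurve m n).sha 5)) :=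
  ⟨fun hSel ↦ (shaCorank_eq_zero_of_natCard_selmerGroup_zywinaCurve h 5 (by norm_num) hSel).1,
    fun heq ↦ (schneider_and_finite_sha_five_of_order_eq_two_zywinaCurve h85 h hf hkato heq).2⟩

end Zywina

/-! ## §3 On the infinite class (mod `hInf` of `…Infinite`) -/

/-- **Descent door on an infinite class of rank-2 curves** (mod `hInf`, `h85`, `hMC`): infinitely many `j(E)`, `E/ℚ` of
rank `2` with `5` good ordinary, `E[5]` irreducible, `25 ∣ #Sel^{(5)}(E/ℚ)`, and: `#Sel^{(5)}(E/ℚ) = 25 ⟹ Ш(E)[5^∞] = 0`,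
and for the newform `f` of `E`, `#Sel^{(5)}(E/ℚ) = 25 → Reg_5(E) ≠ 0 → ord_{T=0} L_5(E,T) = 2`. CONDITIONAL on `hInf`,
`h85`, `hMC`. [cite: Zywina2025, Thm 1.1 and Thm 1.2] [cite: SilvermanAEC2009, Thm X.4.2]
[cite: BalakrishnanMullerStein2015, Thm. 1.7] [cite: BurungaleCastellaSkinner2025, Thm. 1.1.2 (a)] -/
theorem infinite_setOf_j_rankTwo_descentDoor_five [Fact (Nat.Prime 5)]
    (hInf : {mn : ℕ × ℕ | ZywinaAdmissible mn.1 mn.2 ∧ 7 ∣ mn.2}.Infinite)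
    (h85 : Schneider1985_order_charGenerator) (hMC : burungale_castella_skinner_charIdeal_eq_padicLFunction) :
    {j : ℚ | ∃ (W : WeierstrassCurve ℚ) (hW : W.IsElliptic) (_ : W.IsGloballyMinimal),
      @WeierstrassCurve.j _ _ W hW = j ∧ W.mordellWeilRank = 2 ∧ W.HasGoodReductionAtPrime 5 ∧
      ¬ ((5 : ℕ) : ℤ) ∣ W.frobeniusTrace 5 ∧ W.HasIrreducibleModPGaloisRep 5 ∧
      5 ^ 2 ∣ Nat.card (W.selmerGroup (5 : ℕ)) ∧
      (Nat.card (W.selmerGroup (5 : ℕ)) = 5 ^ 2 → AddCommGroup.primaryComponent W.sha 5 = ⊥) ∧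
      ∀ {N : ℕ} [NeZero N] (f : CuspForm (Gamma0 N) 2), IsNewformOf W f →
        Nat.card (W.selmerGroup (5 : ℕ)) = 5 ^ 2 →
          (∀ Dh : PAdicHeightData W 5, Dh.IsCanonical → SchneiderConjecture Dh) →
            (padicLFunction f (unitRoot W 5 : ℚ_[5])).order = 2}.Infinite := by
  refine Set.infinite_of_injOn_mapsTo injOn_j_admissible_seven ?_ hInf
  rintro ⟨m, n⟩ ⟨hq, h7⟩
  haveI := isElliptic_zywinaCurve hq
  haveI := isGloballyMinimal_zywinaCurve hq
  obtain ⟨hgood, hord⟩ := goodOrdinary_five_zywinaCurve hq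
  exact ⟨zywinaCurve m n, isElliptic_zywinaCurve hq, isGloballyMinimal_zywinaCurve hq, by simp only [dif_pos hq],
    mordellWeilRank_zywinaCurve hq, hgood, hord, hasIrreducibleModPGaloisRep_five_zywinaCurve hq h7,
    sq_dvd_natCard_selmerGroup_zywinaCurve hq (by norm_num) (by norm_num),
    fun hSel ↦ (shaCorank_eq_zero_of_natCard_selmerGroup_zywinaCurve hq 5 (by norm_num) hSel).1,
    fun f hf hSel hReg ↦ order_eq_two_of_natCard_selmerGroup_five_zywinaCurve h85 hMC hq h7 hReg hf hSel⟩

end Summit.BirchSwinnertonDyer.BirchSwinnertonDyer.Theorems.ShaPrimaryTransferZywinaEqualityDoorDescent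

end
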